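import Literature.AlgebraicGeometry.Resolution.PsiBirationalChart
import Literature.AlgebraicGeometry.Resolution.BlowupDimension
import Literature.AlgebraicGeometry.Resolution.BlowupStalkCharts
import Literature.AlgebraicGeometry.Resolution.AffineBlowupAlgebra
import Literature.AlgebraicGeometry.Resolution.BennettDimOne
import Literature.AlgebraicGeometry.Resolution.ExcellentRingsEssFiniteType
import Mathlib.RingTheory.LocalProperties.Reduced
import HarnessLib

/-!
# Blowing ups of ARBITRARY locally noetherian schemes: reducedness is preserved and the
# dimension of local rings does not increase

Topic: `Literature/AlgebraicGeometry/Resolution`. Two permanence properties of a blowing up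
`π : X' → X` (`IsBlowup π J`, any centre `J`) which the tree proves for INTEGRAL `X` only
(`IsBlowup.isReduced`, `IsBlowup.ringKrullDim_stalk_le`, `IsBlowup.topologicalKrullDim_le` of
`BlowupsIntegral.lean` / `BlowupDimension.lean`), here PROVED for arbitrary `X`, as needed to
iterate blow-ups of the REDUCED (reducible, non-equidimensional) excellent schemes of dimension
`≤ 2` of Cossart–Jannsen–Saito's Thm. 1.2 (`CossartJannsenSaito2020General`; CJS, proof of
Thm. 6.6: "for reduced `X` every `X_i` is reduced"; Thm. 3.10: "`dim X = dim X'`"). Both are read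
off the chart presentation `𝒪_{X',x'} = (B_j)_𝔴`, `B_j = 𝒪_{X,x}[J_x/c_j] ↪ 𝒪_{X,x}[1/c_j]`
(`IsBlowup.exists_reesChart_stalk`, Stacks 0804, 07Z3) and the component bookkeeping of
`PsiBirationalChart.lean`:

* `ringKrullDim_le_of_forall_minimalPrimes` — `dim R ≤ n` as soon as `dim R/𝔭 ≤ n` for every
  minimal prime `𝔭` (every chain of primes starts above a minimal one);
* `isReduced_of_isLocalization_chart` — a localization of a subring of a localization of a
  reduced ring is reduced; `IsBlowup.isReduced_of_isReduced` — **a blowing up of a reduced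
  locally noetherian scheme is reduced**;
* `ringKrullDim_le_of_isLocalization_chart` — **`dim 𝒪' ≤ dim 𝒪`** for `𝒪' = C_P`, `C ↪ M⁻¹𝒪`
  finitely generated over the noetherian local ring `𝒪`, `P` over `𝔪_𝒪` (NO residual and no
  catenarity hypothesis): for a minimal prime `Q'' = Q'𝒪'` of `𝒪'`,
  `dim 𝒪'/Q'' = ht_{C/Q'}(P/Q') ≤ ht_{𝒪/Q}(𝔪/Q) = dim 𝒪/Q ≤ dim 𝒪` by the dimension inequality
  (Matsumura Thm. 15.5, `height_le_height_of_liesOver_of_finiteType_of_isAlgebraic`) for the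
  birational extension of domains `𝒪/Q ⊆ C/Q'`;
* `IsBlowup.ringKrullDim_stalk_le_of_isLocallyNoetherian`, `IsBlowup.coheight_le_of_isLocallyNoetherian`,
  `IsBlowup.topologicalKrullDim_le_of_isLocallyNoetherian` — **`dim 𝒪_{X',x'} ≤ dim 𝒪_{X,π x'}`,
  `codim x' ≤ codim (π x')`, `dim X ≤ n ⟹ dim X' ≤ n`** for blow-ups of arbitrary locally
  noetherian schemes;
* `IsBlowup.isUniversallyCatenaryRing_stalk` — **`𝒪_{X',x'}` is universally catenary if
  `𝒪_{X,π x'}` is** (it is essentially of finite type over it; Stacks 0ECE, 00NJ), so the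
  hypothesis "`𝒪_{X,x}` universally catenary" of the `H_X`-monotonicity theorems propagates along a
  sequence of blow-ups.

No definitions and no named facts are introduced.

## Sources

* V. Cossart, U. Jannsen, S. Saito, *Desingularization: Invariants and Strategy*, LNM 2270
  (2020), Thm. 6.6 (reducedness of the `X_i`), Thm. 3.10 (proof: `dim X = dim X'`).
  [CossartJannsenSaito2020]
* H. Matsumura, *Commutative Ring Theory* (1986), Thm. 15.5. [Matsumura1987]
* The Stacks Project, Tags 0804, 07Z3, 02ND. [StacksProject]
-/

noncomputable section

open CategoryTheory AlgebraicGeometry IsLocalRing Polynomial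
open Literature.AlgebraicGeometry.Resolution

/-! ## Ring-level statements -/

namespace Literature.RingTheory.HilbertSamuel

universe u

/-- **`dim R ≤ n` if `dim R/𝔭 ≤ n` for all minimal primes `𝔭`**: every strictly increasing chain
of primes lies above a minimal prime `𝔭 ⊆` its first member, hence is a chain of `Spec R/𝔭`.
[folklore] -/
theorem ringKrullDim_le_of_forall_minimalPrimes {R : Type u} [CommRing R] {n : WithBot ℕ∞}
    (h : ∀ p ∈ minimalPrimes R, ringKrullDim (R ⧸ p) ≤ n) : ringKrullDim R ≤ n := by
  rw [ringKrullDim, Order.krullDim]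
  refine iSup_le fun l => ?_
  obtain ⟨p, hp, hp'⟩ := Ideal.exists_minimalPrimes_le (J := l.head.asIdeal) bot_le
  -- `l` is a chain in the zero locus of `p`
  let l' : LTSeries (PrimeSpectrum.zeroLocus (R := R) p) :=
    LTSeries.mk l.length (fun i => ⟨l i, fun r hr => (hp'.trans (l.head_le i)) hr⟩)
      (fun i j hij => l.strictMono hij)
  have h1 : (l.length : WithBot ℕ∞) = l'.length := rfl
  rw [h1]
  refine (Order.LTSeries.length_le_krullDim l').trans ?_
  rw [← ringKrullDim_quotient]
  exact h p hp

section Chart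

variable {O : Type u} [CommRing O] (M : Submonoid O) (S : Type u) [CommRing S] [Algebra O S]
  [IsLocalization M S] (C : Type u) [CommRing C] [Algebra O C] [Algebra C S] [IsScalarTower O C S]
  (P : Ideal C) [P.IsPrime] (O' : Type u) [CommRing O'] [Algebra C O'] [IsLocalization.AtPrime O' P]

omit [Algebra O C] [IsScalarTower O C S] in
include M S P in
/-- **A localization of a subring of a localization of a reduced ring is reduced** (the local
rings of a blowing up of a reduced scheme). [folklore] -/
theorem isReduced_of_isLocalization_chart [IsReduced O] (hinj : Function.Injective (algebraMap C S)) :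
    IsReduced O' := by
  haveI : IsReduced S := isReduced_localizationPreserves M S inferInstance
  haveI : IsReduced C := isReduced_of_injective (algebraMap C S) hinj
  exact isReduced_localizationPreserves P.primeCompl O' inferInstance

include M S in
/-- **`dim 𝒪' ≤ dim 𝒪` for the local rings `𝒪' = C_P` of a birational chart `C ↪ M⁻¹𝒪` of finite
type over a noetherian local ring `𝒪`, `P ⊇ 𝔪_𝒪`** — with no hypothesis on residue fields or
catenarity: `dim 𝒪'/Q'' = ht_{C/Q'}(P/Q') ≤ ht_{𝒪/Q}(𝔪/Q) = dim 𝒪/Q ≤ dim 𝒪` for every minimal prime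
`Q'' = Q'𝒪'` of `𝒪'` (Matsumura Thm. 15.5 for `𝒪/Q ⊆ C/Q' ⊆ Frac(𝒪/Q)`).
[cite: Matsumura1987, Thm. 15.5] [cite: CossartJannsenSaito2020, Thm. 3.10 (proof)] -/
theorem ringKrullDim_le_of_isLocalization_chart [IsLocalRing O] [IsNoetherianRing O]
    [Algebra.FiniteType O C] [P.LiesOver (maximalIdeal O)]
    (hinj : Function.Injective (algebraMap C S)) : ringKrullDim O' ≤ ringKrullDim O := by
  haveI : IsNoetherianRing C := Algebra.FiniteType.isNoetherianRing O C
  haveI : IsNoetherianRing O' := IsLocalization.isNoetherianRing P.primeCompl O' inferInstance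
  refine ringKrullDim_le_of_forall_minimalPrimes fun Q'' hQ'' => ?_
  obtain ⟨hQ', hQ'P, hmap⟩ :=
    under_mem_minimalPrimes_and_le_of_mem_minimalPrimes_localization C P O' hQ''
  set Q' : Ideal C := Q''.under C with hQ'def
  haveI : Q'.IsPrime := hQ'.1.1
  set Q : Ideal O := Q'.under O with hQdef
  have hQmin : Q ∈ minimalPrimes O := under_mem_minimalPrimes_of_mem_minimalPrimes M S C hinj hQ'
  haveI : Q.IsPrime := hQmin.1.1
  -- the domains `A = 𝒪/Q ⊆ B = C/Q'`
  haveI : Nontrivial (O ⧸ Q) := Ideal.Quotient.nontrivial_iff.mpr (Ideal.IsPrime.ne_top inferInstance)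
  haveI : IsLocalRing (O ⧸ Q) :=
    IsLocalRing.of_surjective' (Ideal.Quotient.mk Q) Ideal.Quotient.mk_surjective
  haveI : Algebra.FiniteType (O ⧸ Q) (C ⧸ Q') :=
    Algebra.FiniteType.of_restrictScalars_finiteType O (O ⧸ Q) (C ⧸ Q')
  haveI : Algebra.IsAlgebraic (O ⧸ Q) (C ⧸ Q') :=
    isAlgebraic_quotient_of_mem_minimalPrimes M S C hinj hQ'
  -- the prime `P̄ = P/Q'` of `B`, over the maximal ideal of `A`
  set Pb : Ideal (C ⧸ Q') := P.map (Ideal.Quotient.mk Q') with hPb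
  have hkerP : RingHom.ker (Ideal.Quotient.mk Q') ≤ P := by rwa [Ideal.mk_ker]
  haveI hPbprime : Pb.IsPrime := Ideal.map_isPrime_of_surjective Ideal.Quotient.mk_surjective hkerP
  have hcomapPb : Pb.comap (Ideal.Quotient.mk Q') = P := by
    rw [hPb, Ideal.comap_map_of_surjective _ Ideal.Quotient.mk_surjective,
      ← RingHom.ker_eq_comap_bot, Ideal.mk_ker, sup_eq_left.mpr hQ'P]
  have hQm : Q ≤ maximalIdeal O := IsLocalRing.le_maximalIdeal (Ideal.IsPrime.ne_top inferInstance)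
  have hmaxA : (maximalIdeal O).map (Ideal.Quotient.mk Q) = maximalIdeal (O ⧸ Q) := by
    rw [← Ideal.Quotient.algebraMap_eq]
    exact map_maximalIdeal_eq_of_surjective Ideal.Quotient.mk_surjective
  haveI : Pb.LiesOver (maximalIdeal (O ⧸ Q)) := by
    refine ⟨?_⟩
    apply Ideal.comap_injective_of_surjective (Ideal.Quotient.mk Q) Ideal.Quotient.mk_surjective
    rw [← hmaxA, Ideal.comap_map_of_surjective _ Ideal.Quotient.mk_surjective,
      ← RingHom.ker_eq_comap_bot, Ideal.mk_ker, sup_eq_left.mpr hQm, Ideal.under_def,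
      Ideal.comap_comap]
    have hcomp : (algebraMap (O ⧸ Q) (C ⧸ Q')).comp (Ideal.Quotient.mk Q) =
        (Ideal.Quotient.mk Q').comp (algebraMap O C) := RingHom.ext fun _ => rfl
    rw [hcomp, ← Ideal.comap_comap, hcomapPb]
    exact P.over_def (maximalIdeal O)
  -- `dim 𝒪'/Q'' = ht P̄ ≤ ht 𝔪_A = dim A ≤ dim 𝒪`
  have h1 : ringKrullDim (O' ⧸ Q'') = (Pb.height : WithBot ℕ∞) := by
    rw [← hmap]
    exact ringKrullDim_quotient_map_eq_height C P O' hQ'P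
  have h2 : Pb.height ≤ (maximalIdeal (O ⧸ Q)).height :=
    height_le_height_of_liesOver_of_finiteType_of_isAlgebraic (maximalIdeal (O ⧸ Q)) Pb
  rw [h1]
  calc (Pb.height : WithBot ℕ∞) ≤ (maximalIdeal (O ⧸ Q)).height := by exact_mod_cast h2
    _ = ringKrullDim (O ⧸ Q) := IsLocalRing.maximalIdeal_height_eq_ringKrullDim
    _ ≤ ringKrullDim O := ringKrullDim_quotient_le Q

end Chart

end Literature.RingTheory.HilbertSamuel

/-! ## On a blowing up -/

namespace Literature.AlgebraicGeometry.Resolution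

open Literature.RingTheory.HilbertSamuel

universe u

variable {X X' : Scheme.{u}} {π : X' ⟶ X} {J : X.IdealSheafData}

/-- **The local rings of a blowing up are localizations of birational charts** — the three
permanence facts read off `IsBlowup.exists_reesChart_stalk`: `𝒪_{X',x'}` is reduced if `𝒪_{X,π x'}`
is, and `dim 𝒪_{X',x'} ≤ dim 𝒪_{X,π x'}`. [cite: StacksProject, Tags 0804, 07Z3]
[cite: Matsumura1987, Thm. 15.5] -/
theorem IsBlowup.isReduced_stalk_and_ringKrullDim_stalk_le [IsLocallyNoetherian X]
    (hπ : IsBlowup π J) (x' : X') :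
    (_root_.IsReduced (X.presheaf.stalk (π.base x')) → _root_.IsReduced (X'.presheaf.stalk x')) ∧
      ringKrullDim (X'.presheaf.stalk x') ≤ ringKrullDim (X.presheaf.stalk (π.base x')) := by
  classical
  obtain ⟨k, c, hc⟩ := Submodule.fg_iff_exists_fin_generating_family.mp
    (IsNoetherian.noetherian (stalkIdeal J (π.base x')))
  obtain ⟨j, 𝔴, χ, hχ, hloc, h𝔴⟩ := hπ.exists_reesChart_stalk x' c hc
  letI algRC : Algebra (X.presheaf.stalk (π.base x')) (chartRing c j) := (chartBase c j).toAlgebra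
  letI algCO : Algebra (chartRing c j) (X'.presheaf.stalk x') := χ.toAlgebra
  have hcj : c j ∈ Ideal.span (Set.range c) := Ideal.mem_span_range_self (f := c) (x := j)
  letI algCS : Algebra (chartRing c j) (Localization.Away (c j)) := (reesChart (c j) hcj).toAlgebra
  haveI hT2 := IsScalarTower.of_algebraMap_eq (R := X.presheaf.stalk (π.base x'))
    (S := chartRing c j) (A := Localization.Away (c j))
    fun r => (reesChart_reesChartBase (c j) hcj r).symm
  haveI : Algebra.FiniteType (X.presheaf.stalk (π.base x')) (chartRing c j) := finiteType_chart c j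
  haveI : IsLocalization.AtPrime (X'.presheaf.stalk x') 𝔴.asIdeal := hloc
  haveI : 𝔴.asIdeal.LiesOver (maximalIdeal (X.presheaf.stalk (π.base x'))) := ⟨h𝔴.symm⟩
  have hinj : Function.Injective (algebraMap (chartRing c j) (Localization.Away (c j))) :=
    reesChart_injective (c j) hcj
  exact ⟨fun _ => isReduced_of_isLocalization_chart (Submonoid.powers (c j)) (Localization.Away (c j))
      (chartRing c j) 𝔴.asIdeal (X'.presheaf.stalk x') hinj,
    ringKrullDim_le_of_isLocalization_chart (Submonoid.powers (c j)) (Localization.Away (c j))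
      (chartRing c j) 𝔴.asIdeal (X'.presheaf.stalk x') hinj⟩

/-- **`𝒪_{X',x'}` is universally catenary whenever `𝒪_{X,π x'}` is**: it is a localization of the
finitely generated `𝒪_{X,π x'}`-algebra `B_j` (Stacks 0ECE, 00NJ). [cite: StacksProject, Tag 0ECE]
[cite: StacksProject, Tag 00NJ] -/
theorem IsBlowup.isUniversallyCatenaryRing_stalk [IsLocallyNoetherian X] (hπ : IsBlowup π J)
    (x' : X') (hUC : IsUniversallyCatenaryRing (X.presheaf.stalk (π.base x'))) :
    IsUniversallyCatenaryRing (X'.presheaf.stalk x') := by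
  classical
  obtain ⟨k, c, hc⟩ := Submodule.fg_iff_exists_fin_generating_family.mp
    (IsNoetherian.noetherian (stalkIdeal J (π.base x')))
  obtain ⟨j, 𝔴, χ, -, hloc, -⟩ := hπ.exists_reesChart_stalk x' c hc
  letI algRC : Algebra (X.presheaf.stalk (π.base x')) (chartRing c j) := (chartBase c j).toAlgebra
  letI algCO : Algebra (chartRing c j) (X'.presheaf.stalk x') := χ.toAlgebra
  haveI : Algebra.FiniteType (X.presheaf.stalk (π.base x')) (chartRing c j) := finiteType_chart c j
  haveI : IsLocalization.AtPrime (X'.presheaf.stalk x') 𝔴.asIdeal := hloc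
  exact (hUC.of_finiteType (chartRing c j)).of_isLocalization 𝔴.asIdeal.primeCompl

/-- **A blowing up of a reduced locally noetherian scheme is reduced** (any centre; for the
reduced schemes of CJS Thm. 1.2: "for reduced `X` every `X_i` is reduced", Thm. 6.6).
[cite: CossartJannsenSaito2020, Thm. 6.6] [cite: StacksProject, Tag 02ND] -/
theorem IsBlowup.isReduced_of_isReduced [IsLocallyNoetherian X] [IsReduced X] (hπ : IsBlowup π J) :
    IsReduced X' := by
  haveI : ∀ x' : X', _root_.IsReduced (X'.presheaf.stalk x') := fun x' =>
    (hπ.isReduced_stalk_and_ringKrullDim_stalk_le x').1 inferInstance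
  exact isReduced_of_isReduced_stalk X'

/-- **Blowing up does not raise the dimension of the local rings**: `dim 𝒪_{X',x'} ≤ dim 𝒪_{X,π x'}`
for a blowing up of an ARBITRARY locally noetherian scheme (the integrality-free form of
`IsBlowup.ringKrullDim_stalk_le`). [cite: Matsumura1987, Thm. 15.5] -/
theorem IsBlowup.ringKrullDim_stalk_le_of_isLocallyNoetherian [IsLocallyNoetherian X]
    (hπ : IsBlowup π J) (x' : X') :
    ringKrullDim (X'.presheaf.stalk x') ≤ ringKrullDim (X.presheaf.stalk (π.base x')) :=
  (hπ.isReduced_stalk_and_ringKrullDim_stalk_le x').2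

/-- In terms of codimension: `codim x' ≤ codim (π x')`, any locally noetherian `X`.
[cite: Matsumura1987, Thm. 15.5] -/
theorem IsBlowup.coheight_le_of_isLocallyNoetherian [IsLocallyNoetherian X] (hπ : IsBlowup π J)
    (x' : X') : Order.coheight x' ≤ Order.coheight (π.base x') := by
  have h := hπ.ringKrullDim_stalk_le_of_isLocallyNoetherian x'
  rw [ringKrullDim_stalk_eq_coheight, ringKrullDim_stalk_eq_coheight] at h
  exact_mod_cast h

/-- **Blowing up an arbitrary locally noetherian scheme does not raise the dimension**:
`dim X ≤ n ⟹ dim X' ≤ n` (CJS: the `X_i` of the canonical sequence of a scheme of dimension `≤ 2`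
have dimension `≤ 2`). [cite: Matsumura1987, Thm. 15.5] [cite: CossartJannsenSaito2020, Thm. 3.10 (proof)] -/
theorem IsBlowup.topologicalKrullDim_le_of_isLocallyNoetherian [IsLocallyNoetherian X]
    (hπ : IsBlowup π J) {n : ℕ} (hX : topologicalKrullDim X ≤ n) : topologicalKrullDim X' ≤ n := by
  rw [topologicalKrullDim_le_iff_forall_coheight_le] at hX ⊢
  exact fun x' => (hπ.coheight_le_of_isLocallyNoetherian x').trans (hX (π.base x'))

end Literature.AlgebraicGeometry.Resolution
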